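import Summits.PneNP.PneNP.Theorems.ConvexRankGatesConvexGateBlindXorDefs

/-!
# `ExactLifting` holds against block-junta factorisations (any size, any gadget size, any shift)

Support file for crux `ConvexGateBlind` (stmt-PneNP-10680), line `xor-door-perfect-completeness`, open stub
`stub_exactLifting` (lead's fragment (a) of `Cruxes/ConvexGateBlind/NOTES.md` §3).

`ExactLifting` asks that every cone factorisation of the shifted Index-lift `viol_F(x[w]) - ε` be large.
The cheap factorisations one knows (the `#F · t³` junta rectangles of the unshifted lift; decision-tree /
Sherali–Adams-type decompositions) are sums of BLOCK-JUNTA terms: non-negative functions `H(x, w)` each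
depending only on the blocks `x_i, w_i`, `i ∈ S`, for a small set `S` of coordinates. This file proves that
such terms can NEVER represent a positive shift of the lift, whatever their number, as soon as the block
degree is at most the degree `d` of a perfect-completeness pseudo-expectation of `F`
(`no_blockJunta_shift`): restrict to constant blocks `x_i = y_i · 𝟙` and a fixed pointer, where every
block-`d`-junta becomes a non-negative `d`-junta of `y`, and apply `Ẽ` (`Ẽ ≥ 0` on those, `Ẽ[viol_F - ε] = -ε`).
So the entire difficulty of the stub lies in rank-one terms `u(x) v(w)` that are NOT block-juntas — the
exact ("error-free") analogue of the junta-approximation step of Göös–Lovett–Meka–Watson–Zuckerman 2016 /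
Kothari–Meka–Raghavendra 2017, which in print always carries an additive error.
-/

set_option linter.dupNamespace false -- `Summit.PneNP.PneNP.…`: summit = sub-problem (D-0017)

namespace Summit.PneNP.PneNP.Theorems.XorDoor

open scoped BigOperators
open Finset

noncomputable section

/-- **No block-junta factorisation of a positive shift of the lift** (binder form of the registered
sub-goal `no_blockJunta_shift` of stmt-PneNP-10680). If `F` carries a degree-`d` perfect-completeness
pseudo-expectation, then for every gadget size `t ≥ 1`, every `ε > 0` and every finite family of
NON-NEGATIVE terms `H l (x, w)` each depending only on the blocks `(x i, w i)`, `i ∈ S l`, with `#(S l) ≤ d`,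
the identity `viol_F(x[w]) - ε = ∑_l H l x w` is impossible — regardless of the number of terms. -/
theorem no_blockJunta_shift_of {m d t : ℕ} {F : Finset (Pool m)} (hE : HasPerfectPseudoExp d F)
    (ht : 1 ≤ t) {ε : ℝ} (hε : 0 < ε) {L : Type} [Fintype L] (S : L → Finset (Fin m))
    (hS : ∀ l, (S l).card ≤ d)
    (H : L → (Fin m → Fin t → ZMod 2) → (Fin m → Fin t) → ℝ)
    (hH0 : ∀ l x w, 0 ≤ H l x w)
    (hHS : ∀ l (x x' : Fin m → Fin t → ZMod 2) (w w' : Fin m → Fin t),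
      (∀ i ∈ S l, x i = x' i) → (∀ i ∈ S l, w i = w' i) → H l x w = H l x' w') :
    ¬ ∀ (x : Fin m → Fin t → ZMod 2) (w : Fin m → Fin t),
        (viol F (fun i => x i (w i)) : ℝ) - ε = ∑ l, H l x w := by
  intro hfact
  obtain ⟨E, hSA, -, hone, hviol⟩ := hE
  -- the fixed pointer and the junta terms on constant blocks
  let w₀ : Fin m → Fin t := fun _ => ⟨0, ht⟩
  -- constant blocks: the string table whose `i`-th block is the constant string `y i`
  let h : L → (Fin m → ZMod 2) → ℝ := fun l y => H l (fun i _ => y i) w₀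
  have hjunta : ∀ l, IsJunta d (h l) := by
    intro l
    refine ⟨S l, hS l, fun y y' hyy' => ?_⟩
    exact hHS l _ _ w₀ w₀ (fun i hi => funext fun _ => hyy' i hi) (fun _ _ => rfl)
  have hpos : ∀ l, 0 ≤ E (h l) := fun l => hSA (h l) (hjunta l) (fun y => hH0 l _ _)
  -- the identity on constant blocks, as an identity of functions of `y`
  have hid : (fun y => (viol F y : ℝ)) - ε • (fun _ => (1 : ℝ)) = ∑ l, h l := by
    funext y
    have := hfact (fun i _ => y i) w₀
    simp only [Pi.sub_apply, Pi.smul_apply, smul_eq_mul, mul_one, Finset.sum_apply]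
    exact this
  -- apply the pseudo-expectation
  have hlhs : E ((fun y => (viol F y : ℝ)) - ε • (fun _ => (1 : ℝ))) = -ε := by
    rw [map_sub, map_smul, hviol, hone, smul_eq_mul, mul_one, zero_sub]
  have hrhs : 0 ≤ E (∑ l, h l) := by
    rw [map_sum]
    exact Finset.sum_nonneg fun l _ => hpos l
  rw [← hid, hlhs] at hrhs
  linarith


/-- **No block-junta factorisation of a positive shift of the lift** — registered sub-goal
`no_blockJunta_shift` of stmt-PneNP-10680, verbatim signature (see `no_blockJunta_shift_of`). -/
theorem no_blockJunta_shift :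
    ∀ {m d t : ℕ} {F : Finset (Pool m)}, HasPerfectPseudoExp d F → 1 ≤ t → ∀ {ε : ℝ}, 0 < ε → ∀ {L :
    Type} [Fintype L] (S : L → Finset (Fin m)), (∀ l, (S l).card ≤ d) → ∀ (H : L → (Fin m → Fin t → ZMod
    2) → (Fin m → Fin t) → ℝ), (∀ l x w, 0 ≤ H l x w) → (∀ l (x x' : Fin m → Fin t → ZMod 2) (w w' : Fin
    m → Fin t), (∀ i ∈ S l, x i = x' i) → (∀ i ∈ S l, w i = w' i) → H l x w = H l x' w') → ¬ ∀ (x : Fin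
    m → Fin t → ZMod 2) (w : Fin m → Fin t), (viol F (fun i => x i (w i)) : ℝ) - ε = ∑ l, H l x w :=
  fun hE ht _ hε _ _ S hS H hH0 hHS => no_blockJunta_shift_of hE ht hε S hS H hH0 hHS

/-- **Corollary: no factorisation into junta RECTANGLES.** In particular `viol_F(x[w]) - ε` is not a
non-negative combination of rectangles `1[x ∈ A] · 1[w ∈ B]` whose sides are cylinders over at most `d`
blocks (`A` depends only on `x_S`, `B` only on `w_S`, `#S ≤ d`) — the shape of every term of the cheap
factorisation of the UNshifted lift. -/
theorem no_juntaRectangle_shift {m d t : ℕ} {F : Finset (Pool m)} (hE : HasPerfectPseudoExp d F)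
    (ht : 1 ≤ t) {ε : ℝ} (hε : 0 < ε) {L : Type} [Fintype L] (S : L → Finset (Fin m))
    (hS : ∀ l, (S l).card ≤ d) (c : L → ℝ) (hc : ∀ l, 0 ≤ c l)
    (A : L → Set (Fin m → Fin t → ZMod 2)) (B : L → Set (Fin m → Fin t))
    (hA : ∀ l (x x' : Fin m → Fin t → ZMod 2), (∀ i ∈ S l, x i = x' i) → (x ∈ A l ↔ x' ∈ A l))
    (hB : ∀ l (w w' : Fin m → Fin t), (∀ i ∈ S l, w i = w' i) → (w ∈ B l ↔ w' ∈ B l)) :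
    ¬ ∀ (x : Fin m → Fin t → ZMod 2) (w : Fin m → Fin t),
        (viol F (fun i => x i (w i)) : ℝ) - ε =
          ∑ l, c l * (Set.indicator (A l) (fun _ => (1 : ℝ)) x) * (Set.indicator (B l) (fun _ => (1 : ℝ)) w) := by
  classical
  refine no_blockJunta_shift_of hE ht hε S hS
    (fun l x w => c l * (Set.indicator (A l) (fun _ => (1 : ℝ)) x) * (Set.indicator (B l) (fun _ => (1 : ℝ)) w))
    (fun l x w => ?_) (fun l x x' w w' hx hw => ?_)
  · refine mul_nonneg (mul_nonneg (hc l) ?_) ?_ <;>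
      exact Set.indicator_nonneg (fun _ _ => zero_le_one) _
  · have hA' : Set.indicator (A l) (fun _ => (1 : ℝ)) x = Set.indicator (A l) (fun _ => (1 : ℝ)) x' := by
      by_cases hx1 : x ∈ A l
      · rw [Set.indicator_of_mem hx1, Set.indicator_of_mem ((hA l x x' hx).1 hx1)]
      · rw [Set.indicator_of_notMem hx1, Set.indicator_of_notMem (fun h => hx1 ((hA l x x' hx).2 h))]
    have hB' : Set.indicator (B l) (fun _ => (1 : ℝ)) w = Set.indicator (B l) (fun _ => (1 : ℝ)) w' := by
      by_cases hw1 : w ∈ B l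
      · rw [Set.indicator_of_mem hw1, Set.indicator_of_mem ((hB l w w' hw).1 hw1)]
      · rw [Set.indicator_of_notMem hw1, Set.indicator_of_notMem (fun h => hw1 ((hB l w w' hw).2 h))]
    rw [hA', hB']

end

end Summit.PneNP.PneNP.Theorems.XorDoor
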